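import Literature.Computability.Complexity.MatchingDerivations
import HarnessLib

/-!
# BBCHPRRWZ Lemma 4.5: growing a matching monomial at an uncovered vertex

Braun–Brown-Cohen–Huq–Pokutta–Raghavendra–Roy–Weitz–Zink, *The matching problem has no small
symmetric SDP*, Math. Program. 165 (2017), Lemma 4.5: "For any partial matching `M` on `2d`
vertices and a vertex `a` not covered by `M`, `x_M ≅_{(𝒫_n, d+1)} Σ_{M₁ = M ∪ {a,u}, u ∉ M ∪ {a}} x_{M₁}`.
Proof. We use the generators `Σ_u x_{au} - 1` to add variables corresponding to edges at `a`, and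
then use `x_{au} x_{uv}` to remove monomials not corresponding to a partial matching."

Here (`Mod2.isCong_xM_grow`) the sum runs over the edges `e ∋ a` of `K_n` avoiding the vertices
of `M` (`freeEdgesAt M a`), and `≅` is the degree-bounded congruence `IsCong (Mod2.system n)` of
`MatchingDerivations.lean`; `verts M` is the vertex set of `M` and `card_verts` records
`|V(M)| = 2|M|` for partial matchings.

## References

* G. Braun et al., *The matching problem has no small symmetric SDP*, Math. Program. 165 (2017)
  643–662, Lemma 4.5 (arXiv:1504.00703, p. 8). [BraunEtAl2016]
-/

noncomputable section

open MvPolynomial Finset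

namespace Literature.Computability.Complexity

namespace Mod2

variable {n : ℕ}

/-! ### Vertices of an edge set -/

/-- The vertices covered by an edge set `M`. [cite: BraunEtAl2016, Lemma 4.5 (p. 8, "a vertex a not covered by M")] -/
def verts (M : Finset (KnEdge n)) : Finset (Fin n) :=
  univ.filter fun v => ∃ e ∈ M, v ∈ (e : Sym2 (Fin n))

/-- Membership in `verts`. [cite: BraunEtAl2016, Lemma 4.5 (p. 8)] -/
theorem mem_verts {M : Finset (KnEdge n)} {v : Fin n} :
    v ∈ verts M ↔ ∃ e ∈ M, v ∈ (e : Sym2 (Fin n)) := by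
  simp [verts]

/-- The edges at `a` avoiding the vertices of `M` ("`u ∉ M ∪ {a}`").
[cite: BraunEtAl2016, Lemma 4.5 (p. 8)] -/
def freeEdgesAt (M : Finset (KnEdge n)) (a : Fin n) : Finset (KnEdge n) :=
  univ.filter fun e => a ∈ (e : Sym2 (Fin n)) ∧ ∀ v ∈ verts M, v ∉ (e : Sym2 (Fin n))

/-- Membership in `freeEdgesAt`. [cite: BraunEtAl2016, Lemma 4.5 (p. 8)] -/
theorem mem_freeEdgesAt {M : Finset (KnEdge n)} {a : Fin n} {e : KnEdge n} :
    e ∈ freeEdgesAt M a ↔ a ∈ (e : Sym2 (Fin n)) ∧ ∀ v ∈ verts M, v ∉ (e : Sym2 (Fin n)) := by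
  simp [freeEdgesAt]

/-- A free edge at `a ∉ V(M)` is not in `M`. [cite: BraunEtAl2016, Lemma 4.5 (p. 8)] -/
theorem not_mem_of_mem_freeEdgesAt {M : Finset (KnEdge n)} {a : Fin n} {e : KnEdge n}
    (he : e ∈ freeEdgesAt M a) : e ∉ M := by
  intro heM
  obtain ⟨ha, hfree⟩ := mem_freeEdgesAt.1 he
  exact hfree a (mem_verts.2 ⟨e, heM, ha⟩) ha

/-- Adding a free edge keeps a partial matching a partial matching. [cite: BraunEtAl2016, Lemma 4.5 (p. 8)] -/
theorem isPartialMatching_insert {M : Finset (KnEdge n)} (hM : IsPartialMatching M) {a : Fin n}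
    {e : KnEdge n} (he : e ∈ freeEdgesAt M a) : IsPartialMatching (insert e M) := by
  obtain ⟨-, hfree⟩ := mem_freeEdgesAt.1 he
  intro f hf g hg hfg v ⟨hvf, hvg⟩
  rcases mem_insert.1 hf with rfl | hf' <;> rcases mem_insert.1 hg with rfl | hg'
  · exact hfg rfl
  · exact hfree v (mem_verts.2 ⟨g, hg', hvg⟩) hvf
  · exact hfree v (mem_verts.2 ⟨f, hf', hvf⟩) hvg
  · exact hM f hf' g hg' hfg v ⟨hvf, hvg⟩

/-! ### Lemma 4.5 -/

/-- `1 ≅_1 Σ_{e ∋ a} x_e` (the vertex equation at `a`). [cite: BraunEtAl2016, Lemma 4.5 (proof, "we use the generators Σ_u x_{au} - 1")] -/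
theorem isCong_one_sum_X (a : Fin n) :
    IsCong (system n) 1 (1 : MvPolynomial (KnEdge n) ℝ)
      (∑ e ∈ univ.filter (fun e : KnEdge n => a ∈ (e : Sym2 (Fin n))), X e) := by
  classical
  have hgen : IsCong (system n) 1 (system n (Sum.inr (Sum.inr a))) 0 := by
    refine isCong_generator_zero _ ?_
    rw [system_vertex]
    refine (totalDegree_sub _ _).trans (max_le ?_ (by simp))
    exact (totalDegree_finsetSum _ _).trans (Finset.sup_le fun e _ => (totalDegree_X e).le)
  have h := (hgen.symm.add (IsCong.refl (S := system n) (d := 1) (1 : MvPolynomial (KnEdge n) ℝ)))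
  rw [zero_add, system_vertex, sub_add_cancel] at h
  exact h

/-- **BBCHPRRWZ Lemma 4.5.** For an edge set `M` (a partial matching in the paper; not needed) and
a vertex `a` not covered by `M`, `x_M ≅_{(𝒫_n, |M|+1)} Σ_{e ∋ a free} x_{M ∪ {e}}`. [cite: BraunEtAl2016, Lemma 4.5 (p. 8)] -/
theorem isCong_xM_grow {M : Finset (KnEdge n)} {a : Fin n} (ha : a ∉ verts M) :
    IsCong (system n) (M.card + 1) (xM M) (∑ e ∈ freeEdgesAt M a, xM (insert e M)) := by
  classical
  -- `x_M = x_M · 1 ≅ x_M · Σ_{e ∋ a} x_e`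
  have h1 : IsCong (system n) (M.card + 1) (xM M)
      (∑ e ∈ univ.filter (fun e : KnEdge n => a ∈ (e : Sym2 (Fin n))), xM M * X e) := by
    have := (isCong_one_sum_X (n := n) a).mul_left (xM M) (totalDegree_xM_le M)
    rw [mul_one, mul_sum, add_comm] at this
    exact this
  refine h1.trans ?_
  -- split the edges at `a` into free ones and those touching `V(M)`
  rw [← sum_filter_add_sum_filter_not (univ.filter fun e : KnEdge n => a ∈ (e : Sym2 (Fin n)))
    (fun e : KnEdge n => ∀ v ∈ verts M, v ∉ (e : Sym2 (Fin n)))]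
  have hfree : (univ.filter (fun e : KnEdge n => a ∈ (e : Sym2 (Fin n)))).filter
      (fun e : KnEdge n => ∀ v ∈ verts M, v ∉ (e : Sym2 (Fin n))) = freeEdgesAt M a := by
    ext e; simp [freeEdgesAt]
  rw [hfree]
  have hsplit : (∑ e ∈ freeEdgesAt M a, xM (insert e M)) =
      (∑ e ∈ freeEdgesAt M a, xM M * X e) +
        ∑ _e ∈ (univ.filter (fun e : KnEdge n => a ∈ (e : Sym2 (Fin n)))).filter
          (fun e : KnEdge n => ¬ ∀ v ∈ verts M, v ∉ (e : Sym2 (Fin n))),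
          (0 : MvPolynomial (KnEdge n) ℝ) := by
    rw [sum_const_zero, add_zero]
    refine sum_congr rfl fun e he => ?_
    rw [xM_insert (not_mem_of_mem_freeEdgesAt he), mul_comm]
  rw [hsplit]
  refine (IsCong.refl _).add (IsCong.sum fun e he => ?_)
  -- an edge `e ∋ a` meeting `V(M)` at `w ∈ f ∈ M`: `x_M x_e` contains the disjointness axiom `x_f x_e`
  obtain ⟨he, htouch⟩ := mem_filter.1 he
  have hae : a ∈ (e : Sym2 (Fin n)) := (mem_filter.1 he).2
  simp only [not_forall, not_not, exists_prop] at htouch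
  obtain ⟨w, hw, hwe⟩ := htouch
  obtain ⟨f, hfM, hwf⟩ := mem_verts.1 hw
  have hfe : f ≠ e := by
    rintro rfl
    exact ha (mem_verts.2 ⟨f, hfM, hae⟩)
  let p : {p : KnEdge n × KnEdge n //
      p.1 ≠ p.2 ∧ ∃ i : Fin n, i ∈ (p.1 : Sym2 (Fin n)) ∧ i ∈ (p.2 : Sym2 (Fin n))} :=
    ⟨(f, e), hfe, w, hwf, hwe⟩
  have hgen : IsCong (system n) 2 (X f * X e : MvPolynomial (KnEdge n) ℝ) 0 :=
    isCong_generator_zero (S := system n) (Sum.inr (Sum.inl p)) (by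
      change (X f * X e : MvPolynomial (KnEdge n) ℝ).totalDegree ≤ 2
      exact (totalDegree_mul _ _).trans (by rw [totalDegree_X, totalDegree_X]))
  have hrest := hgen.mul_right (xM (M.erase f)) (totalDegree_xM_le _)
  rw [zero_mul] at hrest
  have hxM : xM M * X e = X f * X e * xM (M.erase f) := by
    rw [xM, ← mul_prod_erase M _ hfM, xM]; ring
  rw [hxM]
  refine hrest.mono ?_
  rw [card_erase_of_mem hfM]
  have : 1 ≤ M.card := card_pos.2 ⟨f, hfM⟩
  omega

end Mod2

end Literature.Computability.Complexity
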